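import Literature.Geometry.Lorentzian.OpensCausality
import Literature.Geometry.Lorentzian.CausalityClosedProofs
import Literature.Geometry.Lorentzian.CausalFutureProofs
import Literature.Geometry.Lorentzian.MinkowskiGlobalHyperbolicity
import HarnessLib

/-!
# Past sets and Cauchy hypersurfaces of open sub-spacetimes — bricks for the Killing PROPAGATION
# step β' (`stub_killingPropagation'`, K1a) of the line `direct-method-on-the-cone`, crux
# `BondiBartnikRigidity` (stmt-FinalStateConjecture-10807); worker betaA of lead c3

General causal lemmas about an open sub-spacetime `U` (restricted metric and time orientation,
`LorentzianMetric.restrict`, `TimeOrientation.restrict`) of a time-oriented Lorentzian manifold,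
used by the conditional closer `…KillingPropagationOfFacts.lean` to manufacture a Cauchy
hypersurface of the interior `G` of the Killing domain inside a prescribed neighbourhood of its
initial boundary (the "past-set trick"):

* `isCauchyHypersurface_of_pastSet` — **Cauchy hypersurfaces transfer along past sets**: if
  `P ≤ G` is a past set of `G` along timelike curves, entered by every endless timelike curve of
  `G`, then a Cauchy hypersurface of `P` is a Cauchy hypersurface of `G` (the registered brick
  `stub_killingPropagation_pastSetCauchy` is its `Spacetime 4` instance, signature verbatim);
* `isFutureCausalCurveOn_restrict_iff` — causal curves of `U` are the causal curves of `M` in `U`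
  (companion of the tree's `isFutureTimelikeCurveOn_restrict_iff`);
* `mem_causalFuture_restrict_iff_of_causallyConvex`, `isGloballyHyperbolic_restrict_of_causallyConvex`
  — for a CAUSALLY CONVEX open `U` (`J⁺(p) ∩ J⁻(q) ⊆ U` for `p, q ∈ U`) the causal futures of
  points of `U` are the traces of the ambient ones, so `U` inherits global hyperbolicity
  (causality and compact causal diamonds);
* `exists_isPreconnected_meets` — through every point of `U` passes a preconnected subset of `U`
  meeting a given Cauchy hypersurface of `U` (the trace of an endless timelike curve of `U`).

Everything is proved; no definitions, no named facts.  References: O'Neill 1983, Ch. 14,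
Def. 14.28, p. 412 [ONeillSemiRiemannian1983]; Sbierski 2016, §3.1–3.2 [Sbierski2016AHP].
-/

noncomputable section

-- D-0017: single-problem summit, `Summit.<S>.<S>.…` by design (cf. lakefile `weak.linter.dupNamespace`).
set_option linter.dupNamespace false

open Set Filter Function Topology TopologicalSpace Bundle
open Literature.Geometry.Lorentzian
open scoped Manifold ContDiff Topology

namespace Summit.FinalStateConjecture.FinalStateConjecture.Theorems.BondiBartnikRigidity.DirectMethod

namespace KillingPropagation

section Opens

variable {E : Type*} [NormedAddCommGroup E] [NormedSpace ℝ E] {H : Type*} [TopologicalSpace H]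
  {I : ModelWithCorners ℝ E H} {n : ℕ∞ω} {M : Type*} [TopologicalSpace M] [ChartedSpace H M]
  [IsManifold I ∞ M] {g : LorentzianMetric I n M} {τ : TimeOrientation g}
  (hres : PseudoRiemannianMetric.contMDiff_restrict (I := I) (n := n) (M := M))
  (hτ : τ.contMDiff_restrict)

/-- **Cauchy hypersurfaces transfer along past sets.** Let `P ≤ G` be open sub-spacetimes and
`Sc ⊆ P`. Suppose that `P` is a PAST SET of `G` along timelike curves (a future timelike curve of
`G` which is in `P` at some parameter is in `P` at all earlier parameters) and that every endless
timelike curve of `G` ENTERS `P`. If `Sc` is a Cauchy hypersurface of `P`, it is a Cauchy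
hypersurface of `G`: the part of an endless timelike curve `γ` of `G` inside `P` is an initial
segment of `γ`, endless in `P` (a future endpoint in `P` would be a re-entry point of `γ`, a past
endpoint in `P` a past endpoint of `γ` in `G`), so it meets `Sc` exactly once, and `γ` meets
`Sc ⊆ P` only there. (The device of Sbierski 2016, §3.1, "the corresponding curve segment … can be
considered to be an inextendible timelike curve", for a past set instead of a member of a cover.)
[cite: Sbierski2016AHP, §3.1, proof of the existence of the MCGHD] -/
theorem isCauchyHypersurface_of_pastSet [T2Space M] {G P : Opens M} (hPG : (P : Set M) ⊆ G)
    {Sc : Set M} (hScP : Sc ⊆ P)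
    (hpast : ∀ (γ : ℝ → G) (s : Set ℝ), s.OrdConnected →
      (g.restrict hres G).IsFutureTimelikeCurveOn (τ.restrict hres hτ G) γ s →
      ∀ t ∈ s, (γ t : M) ∈ P → ∀ t' ∈ s, t' ≤ t → (γ t' : M) ∈ P)
    (hentry : ∀ (γ : ℝ → G) (s : Set ℝ),
      (g.restrict hres G).IsEndlessTimelikeCurve (τ.restrict hres hτ G) γ s →
      ∃ t ∈ s, (γ t : M) ∈ P)
    (hP : (g.restrict hres P).IsCauchyHypersurface (τ.restrict hres hτ P) (Subtype.val ⁻¹' Sc)) :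
    (g.restrict hres G).IsCauchyHypersurface (τ.restrict hres hτ G) (Subtype.val ⁻¹' Sc) := by
  classical
  intro γ s hγ
  obtain ⟨hs, hγt, hγf, hγp⟩ := hγ
  obtain ⟨t₀, ht₀, ht₀P⟩ := hentry γ s ⟨hs, hγt, hγf, hγp⟩
  -- the ambient curve
  have hγM : g.IsFutureTimelikeCurveOn τ (Subtype.val ∘ γ) s :=
    (LorentzianMetric.isFutureTimelikeCurveOn_restrict_iff g τ hres hτ _).1 hγt
  have hcontW : ∀ t ∈ s, ContinuousAt γ t := fun t ht ↦ (hγt t ht).1.continuousAt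
  -- the part of `γ` inside `P`
  set O : Set G := Subtype.val ⁻¹' (P : Set M) with hO
  have hOo : IsOpen O := P.2.preimage continuous_subtype_val
  set J : Set ℝ := s ∩ γ ⁻¹' O with hJ_def
  have hJsub : J ⊆ s := inter_subset_left
  have ht₀J : t₀ ∈ J := ⟨ht₀, ht₀P⟩
  have hJmem : ∀ {t}, t ∈ J ↔ t ∈ s ∧ (γ t : M) ∈ P := fun {t} ↦ Iff.rfl
  -- `J` is an initial segment of `s`
  have hJdown : ∀ t ∈ J, ∀ t' ∈ s, t' ≤ t → t' ∈ J := fun t ht t' ht' htt' ↦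
    ⟨ht', hpast γ s hs hγt t ht.1 ht.2 t' ht' htt'⟩
  have hJord : J.OrdConnected := ⟨fun t₁ ht₁ t₂ ht₂ t ht ↦ hJdown t₂ ht₂ t (hs.out ht₁.1 ht₂.1 ht) ht.2⟩
  have hJcc : connectedComponentIn (s ∩ γ ⁻¹' O) t₀ = J :=
    (isPreconnected_iff_ordConnected.2 hJord).connectedComponentIn ht₀J
  -- the piece, as a curve of `P`
  set δ : ℝ → P := fun t ↦ if h : (γ t : M) ∈ P then ⟨γ t, h⟩ else ⟨γ t₀, ht₀P⟩ with hδ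
  have hδval : ∀ t ∈ J, (δ t : M) = γ t := fun t ht ↦ by
    have hmem : (γ t : M) ∈ P := ht.2
    show Subtype.val (if h : (γ t : M) ∈ P then (⟨γ t, h⟩ : P) else (⟨γ t₀, ht₀P⟩ : P)) = γ t
    rw [dif_pos hmem]
  have hδev : ∀ t ∈ J, (Subtype.val ∘ δ) =ᶠ[𝓝 t] (Subtype.val ∘ γ) := fun t ht ↦ by
    have hmem : γ ⁻¹' O ∈ 𝓝 t := (hcontW t ht.1).preimage_mem_nhds (hOo.mem_nhds ht.2)
    filter_upwards [hmem] with t' ht'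
    simp only [comp_apply, hδ, dif_pos (show (γ t' : M) ∈ P from ht')]
  -- `δ` is a future timelike curve of `P` on `J`
  have hδt : (g.restrict hres P).IsFutureTimelikeCurveOn (τ.restrict hres hτ P) δ J := by
    rw [LorentzianMetric.isFutureTimelikeCurveOn_restrict_iff]
    intro t ht
    obtain ⟨hd, h1, h2⟩ := hγM t ht.1
    have hveq : velocity I (Subtype.val ∘ δ) t = velocity I (Subtype.val ∘ γ) t :=
      DFunLike.congr_fun (hδev t ht).mfderiv_eq (1 : ℝ)
    refine ⟨(hδev t ht).mdifferentiableAt_iff.2 hd, ?_, ?_⟩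
    · change g.val (δ t : M) (velocity I (Subtype.val ∘ δ) t) (velocity I (Subtype.val ∘ δ) t) < 0
      rw [hveq, hδval t ht]
      exact h1
    · change (g.val (δ t : M) (velocity I (Subtype.val ∘ δ) t)
          (velocity I (Subtype.val ∘ δ) t) ≤ 0 ∧ velocity I (Subtype.val ∘ δ) t ≠ 0) ∧
        g.val (δ t : M) (τ.vectorField (δ t : M)) (velocity I (Subtype.val ∘ δ) t) < 0
      rw [hveq, hδval t ht]
      exact h2
  -- `δ` is future endless on `J` (in `P`)
  have hδf : IsFutureEndless δ J := by
    refine ⟨⟨t₀, ht₀J⟩, fun q hq ↦ ?_⟩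
    have h1 : HasFutureEndpoint (Subtype.val ∘ δ) J (q : M) :=
      hasFutureEndpoint_subtypeVal_comp_iff.2 hq
    have h2 : HasFutureEndpoint (Subtype.val ∘ γ) J (q : M) := by
      refine h1.congr fun t ↦ ?_
      exact hδval t t.2
    have h3 : HasFutureEndpoint γ J ⟨q, hPG q.2⟩ := hasFutureEndpoint_subtypeVal_comp_iff.1 h2
    rw [← hJcc] at h3
    exact not_hasFutureEndpoint_connectedComponentIn hs hcontW hγf hOo ht₀ ht₀P
      (p := ⟨q, hPG q.2⟩) q.2 h3
  -- `δ` is past endless on `J` (in `P`): `J` is an initial segment of `s`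
  have hδp : IsPastEndless δ J := by
    refine ⟨⟨t₀, ht₀J⟩, fun q hq ↦ ?_⟩
    have h1 : HasPastEndpoint (Subtype.val ∘ δ) J (q : M) :=
      hasPastEndpoint_subtypeVal_comp_iff.2 hq
    have h2 : HasPastEndpoint (Subtype.val ∘ γ) J (q : M) := by
      refine h1.congr fun t ↦ ?_
      exact hδval t t.2
    have h3 : HasPastEndpoint γ J ⟨q, hPG q.2⟩ := hasPastEndpoint_subtypeVal_comp_iff.1 h2
    have h4 : HasPastEndpoint γ s ⟨q, hPG q.2⟩ :=
      (hasPastEndpoint_congr_set ht₀J ht₀ (fun t ht ↦ ⟨fun h ↦ h.1, fun h ↦ hJdown t₀ ht₀J t h ht⟩)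
        _).1 h3
    exact hγp.2 _ h4
  -- hence `δ` meets `Sc` exactly once; so does `γ`
  obtain ⟨t₁, ⟨ht₁J, ht₁S⟩, huniq⟩ := hP δ J ⟨hJord, hδt, hδf, hδp⟩
  have hγt₁ : (γ t₁ : M) ∈ Sc := by
    have : (δ t₁ : M) ∈ Sc := ht₁S
    rwa [hδval t₁ ht₁J] at this
  refine ⟨t₁, ⟨ht₁J.1, hγt₁⟩, fun t₂ ht₂ ↦ ?_⟩
  have ht₂J : t₂ ∈ J := ⟨ht₂.1, hScP ht₂.2⟩
  refine huniq t₂ ⟨ht₂J, ?_⟩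
  show (δ t₂ : M) ∈ Sc
  rw [hδval t₂ ht₂J]
  exact ht₂.2

/-- **A curve in an open sub-spacetime is a future causal curve there iff it is one in the ambient
spacetime** (causal companion of `isFutureTimelikeCurveOn_restrict_iff`: `T_p U = T_p M`, same
metric, time orientation and velocity). O'Neill 1983, Ch. 1, pp. 3–7 (open submanifolds).
[cite: Sbierski2016AHP, §3.1, proof of the existence of the MCGHD] -/
theorem isFutureCausalCurveOn_restrict_iff (U : Opens M) {γ : ℝ → U} {s : Set ℝ} :
    (g.restrict hres U).IsFutureCausalCurveOn (τ.restrict hres hτ U) γ s ↔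
      g.IsFutureCausalCurveOn τ (Subtype.val ∘ γ) s := by
  refine forall₂_congr fun t _ ↦ ?_
  have hv := velocity_subtypeVal_comp (I := I) U γ t
  change (MDifferentiableAt 𝓘(ℝ, ℝ) I γ t ∧
      (g.val (γ t).1 (velocity I γ t) (velocity I γ t) ≤ 0 ∧ (velocity I γ t : E) ≠ 0) ∧
        g.val (γ t).1 (τ.vectorField (γ t).1) (velocity I γ t) < 0) ↔
    (MDifferentiableAt 𝓘(ℝ, ℝ) I (Subtype.val ∘ γ) t ∧
      (g.val (γ t).1 (velocity I (Subtype.val ∘ γ) t) (velocity I (Subtype.val ∘ γ) t) ≤ 0 ∧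
          (velocity I (Subtype.val ∘ γ) t : E) ≠ 0) ∧
        g.val (γ t).1 (τ.vectorField (γ t).1) (velocity I (Subtype.val ∘ γ) t) < 0)
  rw [mdifferentiableAt_subtypeVal_comp_curve_iff, hv]
  exact Iff.rfl

/-- **Causal futures of points in a causally convex open sub-spacetime are the traces of the
ambient ones**: if `J⁺(p) ∩ J⁻(q) ⊆ U` for all `p, q ∈ U`, then for `p, x ∈ U`,
`x ∈ J⁺_U(p) ↔ x ∈ J⁺(p)` (a causal curve of `M` from `p` to `x` lies in `U` and is a causal curve
of `U` there). O'Neill 1983, Ch. 14, p. 402. [folklore] -/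
theorem mem_causalFuture_restrict_iff_of_causallyConvex {U : Opens M}
    (hconv : ∀ p ∈ (U : Set M), ∀ q ∈ (U : Set M),
      g.causalFuture τ {p} ∩ g.causalPast τ {q} ⊆ U) (p x : U) :
    x ∈ (g.restrict hres U).causalFuture (τ.restrict hres hτ U) {p} ↔
      (x : M) ∈ g.causalFuture τ {(p : M)} := by
  classical
  constructor
  · rintro (hx | ⟨p', hp', γ, a, b, hab, hγ, hγa, hγb⟩)
    · rw [mem_singleton_iff] at hx
      rw [hx]
      exact LorentzianMetric.subset_causalFuture g τ _ (mem_singleton _)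
    · rw [mem_singleton_iff] at hp'
      refine Or.inr ⟨(p : M), rfl, Subtype.val ∘ γ, a, b, hab,
        (isFutureCausalCurveOn_restrict_iff hres hτ U).1 hγ, ?_, ?_⟩
      · simp [hγa, hp']
      · simp [hγb]
  · rintro (hx | ⟨p', hp', γ, a, b, hab, hγ, hγa, hγb⟩)
    · rw [mem_singleton_iff] at hx
      have : x = p := Subtype.ext hx
      rw [this]
      exact LorentzianMetric.subset_causalFuture _ _ _ (mem_singleton _)
    · rw [mem_singleton_iff] at hp'
      subst hp'
      -- the ambient curve lies in `U`
      have hγU : ∀ t ∈ Icc a b, γ t ∈ (U : Set M) := by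
        intro t ht
        refine hconv p p.2 x x.2 ⟨?_, LorentzianMetric.mem_causalPast_singleton_iff.2 ?_⟩
        · rcases ht.1.eq_or_lt with h | h
          · rw [← h, hγa]; exact LorentzianMetric.subset_causalFuture g τ _ (mem_singleton _)
          · exact Or.inr ⟨γ a, hγa, γ, a, t, h, hγ.mono (Icc_subset_Icc_right ht.2), rfl, rfl⟩
        · rcases ht.2.eq_or_lt with h | h
          · rw [h, hγb]; exact LorentzianMetric.subset_causalFuture g τ _ (mem_singleton _)
          · exact Or.inr ⟨γ t, rfl, γ, t, b, h, hγ.mono (Icc_subset_Icc_left ht.1), rfl, hγb⟩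
      -- its lift to `U`
      set δ : ℝ → U := fun t ↦ if h : γ t ∈ (U : Set M) then ⟨γ t, h⟩ else p with hδ
      have hδval : ∀ t ∈ Icc a b, (δ t : M) = γ t := fun t ht ↦ by
        simp only [hδ, dif_pos (hγU t ht)]
      have hδev : ∀ t ∈ Icc a b, (Subtype.val ∘ δ) =ᶠ[𝓝 t] γ := fun t ht ↦ by
        have hmem : γ ⁻¹' (U : Set M) ∈ 𝓝 t :=
          (hγ.continuousAt ht).preimage_mem_nhds (U.2.mem_nhds (hγU t ht))
        filter_upwards [hmem] with t' ht'
        simp only [comp_apply, hδ, dif_pos (show γ t' ∈ (U : Set M) from ht')]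
      have hδc : (g.restrict hres U).IsFutureCausalCurveOn (τ.restrict hres hτ U) δ (Icc a b) := by
        rw [isFutureCausalCurveOn_restrict_iff]
        intro t ht
        obtain ⟨hd, h2⟩ := hγ t ht
        have hveq : velocity I (Subtype.val ∘ δ) t = velocity I γ t :=
          DFunLike.congr_fun (hδev t ht).mfderiv_eq (1 : ℝ)
        refine ⟨(hδev t ht).mdifferentiableAt_iff.2 hd, ?_⟩
        have hpt : (Subtype.val ∘ δ) t = γ t := hδval t ht
        exact (LorentzianMetric.isFutureDirected_congr_point hpt hveq).2 h2
      refine Or.inr ⟨p, rfl, δ, a, b, hab, hδc, ?_, ?_⟩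
      · exact Subtype.ext ((hδval a ⟨le_rfl, hab.le⟩).trans hγa)
      · exact Subtype.ext ((hδval b ⟨hab.le, le_rfl⟩).trans hγb)

/-- **An open causally convex subset of a globally hyperbolic spacetime is a globally hyperbolic
sub-spacetime**: it contains no closed causal curve (its causal curves are causal curves of `M`),
and its causal diamonds `J⁺_U(p) ∩ J⁻_U(q)` are the compact diamonds `J⁺(p) ∩ J⁻(q) ⊆ U` of `M`.
O'Neill 1983, Ch. 14, p. 412 (global hyperbolicity) with the causal convexity of Sbierski 2016,
§3.2. [cite: Sbierski2016AHP, §3.2, proof of Prop. 13 (arXiv numbering)] -/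
theorem isGloballyHyperbolic_restrict_of_causallyConvex (hG : g.IsGloballyHyperbolic τ) {U : Opens M}
    (hconv : ∀ p ∈ (U : Set M), ∀ q ∈ (U : Set M),
      g.causalFuture τ {p} ∩ g.causalPast τ {q} ⊆ U) :
    (g.restrict hres U).IsGloballyHyperbolic (τ.restrict hres hτ U) := by
  refine ⟨fun γ a b hab hγ heq ↦ ?_, fun p q ↦ ?_⟩
  · exact hG.1 (Subtype.val ∘ γ) a b hab ((isFutureCausalCurveOn_restrict_iff hres hτ U).1 hγ)
      (congrArg Subtype.val heq)
  · have hset : (g.restrict hres U).causalFuture (τ.restrict hres hτ U) {p} ∩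
        (g.restrict hres U).causalPast (τ.restrict hres hτ U) {q} =
        Subtype.val ⁻¹' (g.causalFuture τ {(p : M)} ∩ g.causalPast τ {(q : M)}) := by
      ext x
      simp only [mem_inter_iff, mem_preimage]
      rw [LorentzianMetric.mem_causalPast_singleton_iff, LorentzianMetric.mem_causalPast_singleton_iff,
        mem_causalFuture_restrict_iff_of_causallyConvex hres hτ hconv,
        mem_causalFuture_restrict_iff_of_causallyConvex hres hτ hconv]
    rw [hset, Subtype.isCompact_iff, image_preimage_eq_inter_range, Subtype.range_coe,
      inter_eq_left.2 (hconv p p.2 q q.2)]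
    exact hG.2 p q

/-- **Connected witness of a Cauchy hypersurface of a sub-spacetime**: if `Sc` is a Cauchy
hypersurface of the open sub-spacetime `U` then through every `y₀ ∈ U` passes a preconnected subset
of `U` meeting `Sc` — the trace of an endless timelike curve of `U` through `y₀`
(`exists_isEndlessTimelikeCurve_through`), which meets `Sc`. O'Neill 1983, Ch. 14, Def. 14.28.
[cite: ONeillSemiRiemannian1983, Ch. 14, Def. 14.28 (p. 415)] -/
theorem exists_isPreconnected_meets [T2Space M] [SecondCountableTopology M] [I.Boundaryless]
    [FiniteDimensional ℝ E] (hn : 2 ≤ n) {U : Opens M} {Sc : Set U}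
    (hU : (g.restrict hres U).IsCauchyHypersurface (τ.restrict hres hτ U) Sc) (y₀ : M)
    (hy₀ : y₀ ∈ U) :
    ∃ K : Set M, IsPreconnected K ∧ K ⊆ U ∧ y₀ ∈ K ∧ (K ∩ (Subtype.val '' Sc)).Nonempty := by
  obtain ⟨Δ, D, hΔ, h0, hΔ0⟩ :=
    LorentzianMetric.exists_isEndlessTimelikeCurve_through (g := g.restrict hres U)
      (τ := τ.restrict hres hτ U) hn ⟨y₀, hy₀⟩
  obtain ⟨t₁, ⟨ht₁, ht₁S⟩, -⟩ := hU Δ D hΔ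
  have hcont : ContinuousOn (Subtype.val ∘ Δ) D := fun t ht ↦
    (continuous_subtype_val.continuousAt.comp (hΔ.2.1 t ht).1.continuousAt).continuousWithinAt
  refine ⟨(Subtype.val ∘ Δ) '' D, (isPreconnected_iff_ordConnected.2 hΔ.1).image _ hcont, ?_,
    ⟨0, h0, by simp [hΔ0]⟩, ⟨(Δ t₁ : M), mem_image_of_mem _ ht₁, Δ t₁, ht₁S, rfl⟩⟩
  rintro _ ⟨t, -, rfl⟩
  exact (Δ t).2

end Opens

end KillingPropagation

open KillingPropagation in
/-- **Registered brick `stub_killingPropagation_pastSetCauchy` of `stub_killingPropagation'`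
(K1a β')**: Cauchy hypersurfaces transfer along past sets, for the open sub-spacetimes `P ≤ G` of a
`Spacetime 4` (instance of `isCauchyHypersurface_of_pastSet`).
[cite: Sbierski2016AHP, §3.1, proof of the existence of the MCGHD] -/
theorem stub_killingPropagation_pastSetCauchy : ∀ (𝒮 : Spacetime.{0} 4) (G P : Opens 𝒮.carrier) (Sc : Set 𝒮.carrier), (P : Set 𝒮.carrier) ⊆ G → Sc ⊆ P → (∀ (γ : ℝ → G) (s : Set ℝ), s.OrdConnected → (𝒮.metric.restrict PseudoRiemannianMetric.contMDiff_restrict_holds G).IsFutureTimelikeCurveOn (𝒮.timeOrientation.restrict PseudoRiemannianMetric.contMDiff_restrict_holds 𝒮.timeOrientation.contMDiff_restrict_holds G) γ s → ∀ t ∈ s, (γ t : 𝒮.carrier) ∈ P → ∀ t' ∈ s, t' ≤ t → (γ t' : 𝒮.carrier) ∈ P) → (∀ (γ : ℝ → G) (s : Set ℝ), (𝒮.metric.restrict PseudoRiemannianMetric.contMDiff_restrict_holds G).IsEndlessTimelikeCurve (𝒮.timeOrientation.restrict PseudoRiemannianMetric.contMDiff_restrict_holds 𝒮.timeOrientation.contMDiff_restrict_holds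 G) γ s → ∃ t ∈ s, (γ t : 𝒮.carrier) ∈ P) → (𝒮.metric.restrict PseudoRiemannianMetric.contMDiff_restrict_holds P).IsCauchyHypersurface (𝒮.timeOrientation.restrict PseudoRiemannianMetric.contMDiff_restrict_holds 𝒮.timeOrientation.contMDiff_restrict_holds P) (Subtype.val ⁻¹' Sc) → (𝒮.metric.restrict PseudoRiemannianMetric.contMDiff_restrict_holds G).IsCauchyHypersurface (𝒮.timeOrientation.restrict PseudoRiemannianMetric.contMDiff_restrict_holds 𝒮.timeOrientation.contMDiff_restrict_holds G) (Subtype.val ⁻¹' Sc) :=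
  fun _ _ _ _ hPG hScP hpast hentry hP ↦
    isCauchyHypersurface_of_pastSet _ _ hPG hScP hpast hentry hP

end Summit.FinalStateConjecture.FinalStateConjecture.Theorems.BondiBartnikRigidity.DirectMethod

end
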